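import Summits.Ventures.PercRepro.S1PoorCapBridge
import Summits.Ventures.PercRepro.S1FiveCircuitsSolidCaseOneFive
import Summits.Ventures.PercRepro.S1FiveCircuitsSolidSixSharp

/-!
# PercRepro — THE PLANE-POOR 8-SPREAD PER-POINT TABLE AT NULLITIES `3` AND `4`: `t(3) = 5`, `t(4) = 8` ARE THEOREMS
(p1, gen 34)

`proofs/P1-S2-CORANK6.md` §4n. The bridge `S1PoorCapBridge.ncard_fourCircuitsThrough_le_of_fourCapSpecPoor` counts
the 4-circuits through a SIMPLE point; an arbitrary point `f` of a plane-poor 8-spread matroid `N` is reduced to a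
simple one by deleting `Z = cl {f} ∖ {f}` (the loops and the parallel partners of `f`): no 4-circuit through `f`
meets `Z`, the class is deletion-closed, `f` is simple in `N ＼ Z`, and the nullity does not grow
(`ncard_fourCircuitsThrough_le_of_fourCapSpecPoor'`). With the abstract instances `fourCapSpecPoor_three /
_four` (from the landed `fourCapSpec_three / _four`) this gives THE TABLE AT `j = 3, 4`:
**`tPoor_three`** (`≤ 5`) and **`tPoor_four`** (`≤ 8`), hence `tPoor_of_le_four` for every `j ≤ 4`.
Consequences for the cells: `s₅ ≤ 90` on the `(13, 6)` coloop-free spread e-free core MODULO THE TABLE AT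
NULLITY `5` ALONE (`ncard_fiveCircuits_le_ninety_thirteen_six_of_tPoor_five`), and `s₅ ≤ 146` on `(13, 7)`
modulo the table at nullities `5` and `6` (`ncard_fiveCircuits_le_one_forty_six_thirteen_seven_of_tPoor_five_six`).
Nothing about any cell is claimed unconditionally. Axioms: standard.
-/

open scoped Matroid

namespace PercRepro

namespace S1

open Set

open FourCap

variable {α : Type}

/-- The plane-poor class is closed under deleting a set. -/
theorem planePoor_delete_set (N : Matroid α) [N.Finite] (hN : PlanePoor N) (Z : Set α) : PlanePoor (N ＼ Z) := by
  intro D hD h4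
  rw [Matroid.delete_isCircuit_iff] at hD
  rw [Matroid.delete_closure_eq, hD.2.sdiff_eq_left]
  exact (ncard_le_ncard sdiff_subset (N.ground_finite.subset (N.closure_subset_ground D))).trans (hN D hD.1 h4)

/-- The 8-spread class is closed under deleting a set. -/
theorem spread8_delete_set (N : Matroid α) (hN : Spread8 N) (Z : Set α) : Spread8 (N ＼ Z) := by
  rintro ⟨W, hW, h8, hW4⟩
  rw [Matroid.delete_ground] at hW
  refine hN ⟨W, hW.trans sdiff_subset, h8, ?_⟩
  rw [Matroid.delete_eq_restrict, Matroid.restrict_eRk_eq N hW] at hW4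
  exact hW4

/-- Deleting a set does not increase the nullity: `N ＼ Z` has nullity `d' ≤ d`. -/
theorem exists_nullity_le_of_delete (N : Matroid α) [N.Finite] {d : ℕ} (hd : N.E.encard = N.eRank + d)
    (Z : Set α) : ∃ d' ≤ d, (N ＼ Z).E.encard = (N ＼ Z).eRank + d' := by
  have h1 := encard_le_eRk_add_of_subset N (sdiff_subset : N.E \ Z ⊆ N.E) hd
  rw [Matroid.delete_ground, Matroid.delete_eq_restrict, Matroid.eRank_restrict]
  have hfin : (N.E \ Z).Finite := N.ground_finite.subset sdiff_subset
  have hrne : N.eRk (N.E \ Z) ≠ ⊤ := ne_top_of_le_ne_top hfin.encard_lt_top.ne (N.eRk_le_encard _)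
  obtain ⟨r, hr⟩ := ENat.ne_top_iff_exists.1 hrne
  rw [← hr, ← hfin.cast_ncard_eq] at h1 ⊢
  have h2 : (N.E \ Z).ncard ≤ r + d := by exact_mod_cast h1
  have h3 : r ≤ (N.E \ Z).ncard := by
    have := N.eRk_le_encard (N.E \ Z)
    rw [← hr, ← hfin.cast_ncard_eq] at this
    exact_mod_cast this
  refine ⟨(N.E \ Z).ncard - r, by omega, ?_⟩
  have : (N.E \ Z).ncard = r + ((N.E \ Z).ncard - r) := by omega
  conv_lhs => rw [this]
  push_cast
  rfl

/-- A 4-circuit through a point `f` avoids `cl {f} ∖ {f}` (its pairs are independent). -/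
theorem disjoint_closure_singleton_sdiff_of_fourCircuit (N : Matroid α) {C : Set α} (hC : N.IsCircuit C)
    (h4 : C.ncard = 4) {f : α} (hf : f ∈ C) : Disjoint C (N.closure {f} \ {f}) := by
  rw [Set.disjoint_left]
  intro x hxC hxZ
  have hxf : x ≠ f := fun h => hxZ.2 (mem_singleton_iff.2 h)
  have hCfin : C.Finite := finite_of_ncard_pos (by omega)
  have hsub : ({f, x} : Set α) ⊂ C := by
    refine ⟨?_, fun hCsub => ?_⟩
    · intro t ht; simp only [mem_insert_iff, mem_singleton_iff] at ht
      rcases ht with rfl | rfl; exact hf; exact hxC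
    · have := ncard_le_ncard hCsub (finite_insert.2 (finite_singleton x))
      rw [ncard_pair hxf.symm] at this
      omega
  have hind : N.Indep {f, x} := hC.ssubset_indep hsub
  have hnot := hind.notMem_closure_sdiff_of_mem (by simp : x ∈ ({f, x} : Set α))
  have hdiff : ({f, x} : Set α) \ {x} = {f} := by
    ext t; simp only [mem_sdiff, mem_insert_iff, mem_singleton_iff]
    constructor
    · rintro ⟨h | h, hx⟩
      · exact h
      · exact absurd h hx
    · rintro rfl; exact ⟨Or.inl rfl, hxf.symm⟩
  rw [hdiff] at hnot
  exact hnot hxZ.1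

/-- A loop lies on no 4-circuit. -/
theorem ncard_fourCircuitsThrough_eq_zero_of_isLoop (N : Matroid α) {f : α} (hf : N.IsLoop f) :
    {C : Set α | N.IsCircuit C ∧ C.ncard = 4 ∧ f ∈ C}.ncard = 0 := by
  have hempty : {C : Set α | N.IsCircuit C ∧ C.ncard = 4 ∧ f ∈ C} = ∅ := by
    rw [Set.eq_empty_iff_forall_notMem]
    rintro C ⟨hC, h4, hfC⟩
    have := hf.eq_of_isCircuit_mem hC hfC
    rw [this, ncard_singleton] at h4
    omega
  rw [hempty, ncard_empty]

/-- A point outside the ground set lies on no 4-circuit. -/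
theorem ncard_fourCircuitsThrough_eq_zero_of_notMem (N : Matroid α) {f : α} (hf : f ∉ N.E) :
    {C : Set α | N.IsCircuit C ∧ C.ncard = 4 ∧ f ∈ C}.ncard = 0 := by
  have hempty : {C : Set α | N.IsCircuit C ∧ C.ncard = 4 ∧ f ∈ C} = ∅ := by
    rw [Set.eq_empty_iff_forall_notMem]
    rintro C ⟨hC, _, hfC⟩
    exact hf (hC.subset_ground hfC)
  rw [hempty, ncard_empty]

open Classical in
/-- **THE PLANE-POOR BRIDGE AT AN ARBITRARY POINT**: on a finite plane-poor 8-spread matroid of nullity `d`, the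
4-circuits through any point `f` number at most `Q` whenever `FourCapSpecPoor capPoor d Q` holds. A loop or a
point outside the ground set lies on no 4-circuit; otherwise delete `Z = cl {f} ∖ {f}` (the loops and the parallel
partners of `f`): the 4-circuits through `f` are unchanged, `f` is simple in `N ＼ Z`, the class is preserved and
the nullity does not grow, so the simple-point bridge applies at the smaller nullity. -/
theorem ncard_fourCircuitsThrough_le_of_fourCapSpecPoor' (N : Matroid α) [N.Finite] (hpp : PlanePoor N)
    (hN8 : Spread8 N) {d : ℕ} (hd : N.E.encard = N.eRank + d) (f : α) {Q : ℕ}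
    (hspec : FourCapSpecPoor capPoor d Q) :
    {C : Set α | N.IsCircuit C ∧ C.ncard = 4 ∧ f ∈ C}.ncard ≤ Q := by
  by_cases hfE : f ∈ N.E
  swap
  · rw [ncard_fourCircuitsThrough_eq_zero_of_notMem N hfE]; exact Nat.zero_le _
  by_cases hfl : N.IsLoop f
  · rw [ncard_fourCircuitsThrough_eq_zero_of_isLoop N hfl]; exact Nat.zero_le _
  have hnl : N.IsNonloop f := Matroid.isNonloop_of_not_isLoop hfE hfl
  set Z := N.closure {f} \ {f} with hZ
  set N' := N ＼ Z with hN'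
  have hfZ : f ∉ Z := fun h => h.2 (mem_singleton_iff.2 rfl)
  have hfE' : f ∈ N'.E := ⟨hfE, hfZ⟩
  -- the 4-circuits through `f` are the same in `N'`
  have hsame : {C : Set α | N'.IsCircuit C ∧ C.ncard = 4 ∧ f ∈ C} = {C : Set α | N.IsCircuit C ∧ C.ncard = 4 ∧ f ∈ C} := by
    ext C
    simp only [mem_setOf_eq, hN', Matroid.delete_isCircuit_iff]
    constructor
    · rintro ⟨⟨hC, -⟩, h4, hfC⟩; exact ⟨hC, h4, hfC⟩
    · rintro ⟨hC, h4, hfC⟩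
      exact ⟨⟨hC, disjoint_closure_singleton_sdiff_of_fourCircuit N hC h4 hfC⟩, h4, hfC⟩
  rw [← hsame]
  -- `f` is simple in `N'`
  have hs : ∀ p ∈ N'.E, f ≠ p → N'.eRk {f, p} = 2 := by
    intro p hp hfp
    have hpE : p ∈ N.E := hp.1
    have hpZ : p ∉ Z := hp.2
    have hpcl : p ∉ N.closure {f} := fun h => hpZ ⟨h, fun h' => hfp (mem_singleton_iff.1 h').symm⟩
    have hsub : ({f, p} : Set α) ⊆ N.E \ Z := by
      intro t ht; simp only [mem_insert_iff, mem_singleton_iff] at ht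
      rcases ht with rfl | rfl
      · exact ⟨hfE, hfZ⟩
      · exact ⟨hpE, hpZ⟩
    rw [hN', Matroid.delete_eq_restrict, Matroid.restrict_eRk_eq N hsub]
    have h1 : ({f, p} : Set α) = insert p {f} := Set.pair_comm f p
    rw [h1, N.eRk_insert_eq_add_one ⟨hpE, hpcl⟩, hnl.eRk_eq]
    rfl
  obtain ⟨d', hd'd, hd'⟩ := exists_nullity_le_of_delete N hd Z
  exact ncard_fourCircuitsThrough_le_of_fourCapSpecPoor N' hs hfE' (planePoor_delete_set N hpp Z)
    (spread8_delete_set N hN8 Z) hd' (hspec.mono_nullity hd'd)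

/-- **THE TABLE AT NULLITY `3`: `t(3) = 5`** — every finite plane-poor 8-spread matroid of nullity `3` has at most
`5` four-circuits through each point. -/
theorem tPoor_three (N : Matroid α) [N.Finite] (hpp : PlanePoor N) (hN8 : Spread8 N)
    (hd : N.E.encard = N.eRank + 3) (f : α) : {C : Set α | N.IsCircuit C ∧ C.ncard = 4 ∧ f ∈ C}.ncard ≤ 5 :=
  ncard_fourCircuitsThrough_le_of_fourCapSpecPoor' N hpp hN8 hd f fourCapSpecPoor_three

/-- **THE TABLE AT NULLITY `4`: `t(4) = 8`** — every finite plane-poor 8-spread matroid of nullity `4` has at most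
`8` four-circuits through each point. -/
theorem tPoor_four (N : Matroid α) [N.Finite] (hpp : PlanePoor N) (hN8 : Spread8 N)
    (hd : N.E.encard = N.eRank + 4) (f : α) : {C : Set α | N.IsCircuit C ∧ C.ncard = 4 ∧ f ∈ C}.ncard ≤ 8 :=
  ncard_fourCircuitsThrough_le_of_fourCapSpecPoor' N hpp hN8 hd f fourCapSpecPoor_four

/-- **The table holds up to nullity `4`**: `#4circ(f) ≤ tPoor j` for `j ≤ 4` on the plane-poor 8-spread class. -/
theorem tPoor_of_le_four (N : Matroid α) [N.Finite] (hpp : PlanePoor N) (hN8 : Spread8 N) {j : ℕ} (hj : j ≤ 4)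
    (hd : N.E.encard = N.eRank + j) (f : α) :
    {C : Set α | N.IsCircuit C ∧ C.ncard = 4 ∧ f ∈ C}.ncard ≤ tPoor j := by
  by_cases hj2 : j ≤ 2
  · exact tPoor_of_le_two N hj2 hd f
  by_cases hj3 : j = 3
  · subst hj3; exact tPoor_three N hpp hN8 hd f
  have hj4 : j = 4 := by omega
  subst hj4; exact tPoor_four N hpp hN8 hd f

/-- **`s₅ ≤ 90` ON THE `(13, 6)` CORE MODULO THE TABLE AT NULLITY `5` ALONE** (`t(5) = 9` on the plane-poor
8-spread class; `t(3) = 5` and `t(4) = 8` are now theorems). -/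
theorem ncard_fiveCircuits_le_ninety_thirteen_six_of_tPoor_five (M : Matroid α) [M.Finite]
    (hfree : ∀ e ∈ M.E, ∃ A ⊆ M.E \ {e}, e ∉ M.closure A ∧ e ∉ M.closure ((M.E \ {e}) \ A))
    (hns : ¬ ∃ W ⊆ M.E, W.ncard ≤ 9 ∧ W.encard = M.eRk W + 4) (hd : M.E.encard = M.eRank + 6)
    (hn : M.E.ncard = 19) (hK : ∀ e, ¬ M.IsColoop e)
    (ht5 : ∀ (N' : Matroid α) [N'.Finite], PlanePoor N' → Spread8 N' → N'.E.encard = N'.eRank + 5 →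
      ∀ f ∈ N'.E, {D : Set α | N'.IsCircuit D ∧ D.ncard = 4 ∧ f ∈ D}.ncard ≤ 9) :
    {C : Set α | M.IsCircuit C ∧ C.ncard = 5}.ncard ≤ 90 := by
  refine ncard_fiveCircuits_le_ninety_thirteen_six_of_tPoor_three_four_five M hfree hns hd hn hK ?_
  intro N' _ hN' hN8 j hj3 hj5 hj f hf
  by_cases hj4 : j ≤ 4
  · exact tPoor_of_le_four N' hN' hN8 hj4 hj f
  have hj5' : j = 5 := by omega
  subst hj5'
  exact (ht5 N' hN' hN8 hj f hf).trans (le_of_eq (by decide))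

/-- **`s₅ ≤ 146` ON THE `(13, 7)` CORE MODULO THE TABLE AT NULLITIES `5` AND `6` ALONE** (`t(5) = 9`,
`t(6) = 12` on the plane-poor 8-spread class). -/
theorem ncard_fiveCircuits_le_one_forty_six_thirteen_seven_of_tPoor_five_six (M : Matroid α) [M.Finite]
    (hfree : ∀ e ∈ M.E, ∃ A ⊆ M.E \ {e}, e ∉ M.closure A ∧ e ∉ M.closure ((M.E \ {e}) \ A))
    (hns : ¬ ∃ W ⊆ M.E, W.ncard ≤ 9 ∧ W.encard = M.eRk W + 4) (hd : M.E.encard = M.eRank + 7)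
    (hn : M.E.ncard = 20) (hK : ∀ e, ¬ M.IsColoop e)
    (ht5 : ∀ (N' : Matroid α) [N'.Finite], PlanePoor N' → Spread8 N' → N'.E.encard = N'.eRank + 5 →
      ∀ f ∈ N'.E, {D : Set α | N'.IsCircuit D ∧ D.ncard = 4 ∧ f ∈ D}.ncard ≤ 9)
    (ht6 : ∀ (N' : Matroid α) [N'.Finite], PlanePoor N' → Spread8 N' → N'.E.encard = N'.eRank + 6 →
      ∀ f ∈ N'.E, {D : Set α | N'.IsCircuit D ∧ D.ncard = 4 ∧ f ∈ D}.ncard ≤ 12) :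
    {C : Set α | M.IsCircuit C ∧ C.ncard = 5}.ncard ≤ 146 := by
  refine ncard_fiveCircuits_le_one_forty_six_thirteen_seven_of_tPoorSix M hfree hns hd hn hK ?_
  intro N' _ hN' hN8 j hj3 hj6 hj f hf
  by_cases hj4 : j ≤ 4
  · have h := tPoor_of_le_four N' hN' hN8 hj4 hj f
    have h6 : j ≠ 6 := by omega
    simpa [tPoorSix, h6] using h
  by_cases hj5 : j = 5
  · subst hj5
    exact (ht5 N' hN' hN8 hj f hf).trans (le_of_eq (by decide))
  have hj6' : j = 6 := by omega
  subst hj6'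
  exact (ht6 N' hN' hN8 hj f hf).trans (le_of_eq (by decide))

end S1

end PercRepro
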